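import Summits.CriticalPhenomena.Ising3DConformalLimit.Theorems.HyperoctahedralRPExistsScaleCovariantLimitCompactnessItemMaps
import Summits.CriticalPhenomena.Ising3DConformalLimit.Theorems.HyperoctahedralRPExistsScaleCovariantLimitTwoHierarchies
import Summits.CriticalPhenomena.Ising3DConformalLimit.Theorems.HyperoctahedralRPExistsScaleCovariantLimitScaleCovariantOfTwoThree
import Summits.CriticalPhenomena.Ising3DConformalLimit.Theorems.HyperoctahedralRPExistsScaleCovariantLimitPinnedLimitOfDyadic
import Summits.CriticalPhenomena.Ising3DConformalLimit.Theorems.HyperoctahedralRPExistsScaleCovariantLimitDyadicLimitContinuous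
import Summits.CriticalPhenomena.Ising3DConformalLimit.Theorems.HyperoctahedralRPExistsScaleCovariantLimitDyadicConvergenceOf
import Summits.CriticalPhenomena.Ising3DConformalLimit.Theorems.HyperoctahedralRPExistsScaleCovariantLimitTriadicConvergenceOf
import Summits.CriticalPhenomena.Ising3DConformalLimit.Theorems.HyperoctahedralRPExistsScaleCovariantLimitPointwiseBoundedOfTight
import Summits.CriticalPhenomena.Ising3DConformalLimit.Theorems.HyperoctahedralRPExistsScaleCovariantLimitUniqueOfIntConvergence
import Summits.CriticalPhenomena.Ising3DConformalLimit.Theorems.ExistsScaleCovariantLimit.Negative.TightnessUniqueness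
import Summits.CriticalPhenomena.Ising3DConformalLimit.Theorems.ExistsScaleCovariantLimit.Negative.DyadicIdentity
import Summits.CriticalPhenomena.Ising3DConformalLimit.Theorems.MonotoneRGZoomGlue
import HarnessLib

/-!
# Item maps of the UNIQUENESS half of the crux `ExistsScaleCovariantLimit`, IMPORTABLE
(line `Sketch` = crux idea two-hierarchies-force-the-filter, crux item stmt-CriticalPhenomena-1981, route `HyperoctahedralRP`;
registered anchor `stub_uniquenessItemMaps`; lead c5, 2026-08-16)

Compositions of landed modules only (leads 0 and -1: p86553 continuity, p89454 two hierarchies, p90948 §J, p90958 §I; c1: S4 p97282,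
S5 p97840; c2: B p106941, G p107331; c4: T1 p117316) — the same theorems are proved inside the registered skeleton
`Cruxes/ExistsScaleCovariantLimit/Lines/Sketch.lean` (v13), here they become importable (namespace `…TwoHierarchies.ItemMaps`):
* `pinnedLimit_of_twoHierarchies` — K1 (dyadic locally-uniform convergence of the pinned zoom) ∧ K2 (triadic pointwise convergence)
  ⟹ the pinned zoom converges along the FULL filter; `crux_iff_twoHierarchies` — **crux ⟺ K1 ∧ K2** (the line's structural theorem);
* `crux_iff_orbitPrecompact_dyadicInt_triadicInt` — **crux ⟺ item 5955 ∧ S2' ∧ S3'**: beyond tightness, existence of the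
  scale-covariant continuum limit of ALL critical `ℤ³` Ising correlators is EXACTLY the convergence of the explicit real sequences
  `⟨∏ᵢσ_{b^k yᵢ}⟩_{β_c}/⟨σ₀σ_{b^k e₀}⟩_{β_c}^{n/2}` (`b ∈ {2,3}`, `y ∈ (ℤ³)ⁿ` non-coincident) — the registered open stubs S2'/S3';
* `crux_iff_uniformRegularity_dyadicInt_triadicInt` (item 4658 in place of 5955), `crux_iff_pairRegularity_dyadicInt_triadicInt`
  (uniform regularity of the PAIR zoom in place of 5955), `crux_iff_dyadicInt_triadicInt_of_twoPointLaw` (**under item 0634, crux ⟺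
  S2' ∧ S3'**);
* `stub_uniquenessItemMaps` — the registered package.
(The K1 ∧ K2 composition itself is `MonotoneRGZoomGlue.pinnedLimit_of_twoHierarchies'`, p103222, reused.)

References: H. Duminil-Copin, ICM 2022 §8.4 p. 29 ("widely open") [DuminilCopinICM2022]; M. Aizenman, H. Duminil-Copin, Ann. Math.
194 (2021) [AizenmanDuminilCopinAnnals2021]. No definitions, no `sorry`.
-/

noncomputable section

namespace Summit.CriticalPhenomena.Ising3DConformalLimit.Cruxes.ExistsScaleCovariantLimit.TwoHierarchies.ItemMaps

open Literature.Probability.LatticeModels Filter Set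
open scoped Topology
open Summit.CriticalPhenomena.Ising3DConformalLimit.MoebiusLimitExistsOnlyInteraction (rhoPin)
open Summit.CriticalPhenomena.Ising3DConformalLimit.ExistsScaleCovariantLimitNegative.Dyadic
open Summit.CriticalPhenomena.Ising3DConformalLimit.PinnedClusterPoints (cfg01_mem rescaled_pin_cfg01)
open Summit.CriticalPhenomena.Ising3DConformalLimit.Cruxes.ExistsScaleCovariantLimit.TwoHierarchies
open Summit.CriticalPhenomena.Ising3DConformalLimit.Theses

/-! ## Bookkeeping -/

/-- `3^{-k} → 0⁺`. [folklore] -/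
theorem tendsto_triad_nhdsGT : Tendsto (fun k : ℕ => ((3:ℝ) ^ k)⁻¹) atTop (𝓝[>] (0:ℝ)) := by
  refine tendsto_nhdsWithin_iff.2 ⟨?_, Filter.Eventually.of_forall fun k => Set.mem_Ioi.2 (by positivity)⟩
  exact tendsto_inv_atTop_zero.comp (tendsto_pow_atTop_atTop_of_one_lt (by norm_num : (1:ℝ) < 3))

/-- Cast bookkeeping: `((2:ℕ):ℝ) = 2`. [folklore] -/
theorem natCast_two_eq : ((2:ℕ) : ℝ) = (2:ℝ) := by norm_num

/-- Cast bookkeeping: `((3:ℕ):ℝ) = 3`. [folklore] -/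
theorem natCast_three_eq : ((3:ℕ) : ℝ) = (3:ℝ) := by norm_num

/-! ## K1 ∧ K2 ⟹ the pinned limit; crux ⟺ K1 ∧ K2 -/

/-- **K1 ∧ K2 ⟹ the pinned zoom converges along the full filter.** Dyadic convergence (K1) gives, by the landed continuity
theorem (p86553), a limit `S` continuous off the diagonals; with pointwise triadic convergence (K2) the two-hierarchies glue
(p89454) yields the triadic self-consistency of `S`; the dyadic one is automatic; "two primes fix the scale" (§J, p90948) makes
`S` exactly scale covariant; dyadic convergence to a scale-covariant limit is full-filter convergence of the pinned zoom (§I, p90958).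
[cite: DuminilCopinICM2022, §8.4 p. 29] -/
theorem pinnedLimit_of_twoHierarchies
    (hK1 : ∃ S : CorrFamily 3, ∀ n : ℕ,
      TendstoLocallyUniformlyOn
        (fun k : ℕ => rescaledCorrelator (criticalCorr 3) rhoPin n (((2:ℝ) ^ k)⁻¹)) (S n) atTop
        (NonCoincident 3 n))
    (hK2 : ∃ S : CorrFamily 3, ∀ n : ℕ, ∀ x ∈ NonCoincident 3 n,
      Tendsto (fun k : ℕ => rescaledCorrelator (criticalCorr 3) rhoPin n (((3:ℝ) ^ k)⁻¹) x) atTop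
        (𝓝 (S n x))) :
    ∃ S : CorrFamily 3, HasPointwiseScalingLimit (criticalCorr 3) rhoPin S := by
  -- the composition of line `Sketch`, importable since p103222 (`MonotoneRGZoomGlue.pinnedLimit_of_twoHierarchies'`)
  obtain ⟨S, hS⟩ := hK1
  obtain ⟨S', hS'⟩ := hK2
  exact ⟨S, Summit.CriticalPhenomena.Ising3DConformalLimit.MonotoneRGZoomGlue.pinnedLimit_of_twoHierarchies' hS
    (stub_dyadicLimitContinuous S hS) hS'⟩

/-- **crux ⟹ K1 ∧ K2**: under the crux the pinned zoom converges along the full filter (`pinnedLimit_of_crux`), hence along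
`2^{-k}` locally uniformly and along `3^{-k}` pointwise. [folklore] -/
theorem twoHierarchies_of_crux (h : HyperoctahedralRP.ExistsScaleCovariantLimit) :
    (∃ S : CorrFamily 3, ∀ n : ℕ,
      TendstoLocallyUniformlyOn
        (fun k : ℕ => rescaledCorrelator (criticalCorr 3) rhoPin n (((2:ℝ) ^ k)⁻¹)) (S n) atTop
        (NonCoincident 3 n)) ∧
    (∃ S : CorrFamily 3, ∀ n : ℕ, ∀ x ∈ NonCoincident 3 n,
      Tendsto (fun k : ℕ => rescaledCorrelator (criticalCorr 3) rhoPin n (((3:ℝ) ^ k)⁻¹) x) atTop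
        (𝓝 (S n x))) := by
  obtain ⟨S, hlim⟩ :=
    Summit.CriticalPhenomena.Ising3DConformalLimit.ExistsScaleCovariantLimitNegative.pinnedLimit_of_crux h
  exact ⟨⟨S, fun n =>
      Summit.CriticalPhenomena.Ising3DConformalLimit.OnlyInteractionTightness.tendstoLocallyUniformlyOn_comp_tendsto
        (hlim n) tendsto_dyad⟩,
    ⟨S, fun n x hx => ((hlim n).tendsto_at hx).comp tendsto_triad_nhdsGT⟩⟩

/-- **TWO HIERARCHIES ARE THE FULL FILTER (the line's structural theorem, importable).** The crux — existence of the full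
continuum scaling limit of the critical `ℤ³` Ising correlators with continuous scale covariance — is EQUIVALENT to the
conjunction of (K1) convergence of the renormalisation-free pinned zoom along the pure dyadic meshes `2^{-k}` (all `n`, locally
uniformly off the diagonals) and (K2) POINTWISE convergence along the pure triadic meshes `3^{-k}`, to a priori unrelated limits.
[cite: DuminilCopinICM2022, §8.4 p. 29] -/
theorem crux_iff_twoHierarchies :
    HyperoctahedralRP.ExistsScaleCovariantLimit ↔
    ((∃ S : CorrFamily 3, ∀ n : ℕ,
      TendstoLocallyUniformlyOn
        (fun k : ℕ => rescaledCorrelator (criticalCorr 3) rhoPin n (((2:ℝ) ^ k)⁻¹)) (S n) atTop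
        (NonCoincident 3 n)) ∧
    (∃ S : CorrFamily 3, ∀ n : ℕ, ∀ x ∈ NonCoincident 3 n,
      Tendsto (fun k : ℕ => rescaledCorrelator (criticalCorr 3) rhoPin n (((3:ℝ) ^ k)⁻¹) x) atTop
        (𝓝 (S n x)))) :=
  ⟨twoHierarchies_of_crux, fun h =>
    (pinnedLimit_of_twoHierarchies h.1 h.2).elim fun _ hS =>
      Summit.CriticalPhenomena.Ising3DConformalLimit.ExistsScaleCovariantLimitNegative.crux_of_pinnedLimit hS⟩

/-! ## crux ⟺ item 5955 ∧ S2' ∧ S3' -/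

/-- **crux ⟹ item 5955** (`OrbitPrecompact`): the pinned limit is a precompact orbit. [folklore] -/
theorem orbitPrecompact_of_crux (h : HyperoctahedralRP.ExistsScaleCovariantLimit) : MonotoneRG.OrbitPrecompact := by
  obtain ⟨S, hS⟩ :=
    Summit.CriticalPhenomena.Ising3DConformalLimit.ExistsScaleCovariantLimitNegative.pinnedLimit_of_crux h
  exact Summit.CriticalPhenomena.Ising3DConformalLimit.ExistsScaleCovariantLimitNegative.orbitPrecompact_of_pinnedLimit hS

/-- **crux ⟹ S2'**: under the crux the pinned zoom converges along the full filter, in particular along `2^{-k}` at every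
non-coincident configuration. [folklore] -/
theorem dyadicIntConvergence_of_crux (h : HyperoctahedralRP.ExistsScaleCovariantLimit) :
    ∀ (n : ℕ) (y : Fin n → EuclideanSpace ℝ (Fin 3)), y ∈ NonCoincident 3 n →
      (∀ i j, ∃ z : ℤ, y i j = (z : ℝ)) →
      ∃ L : ℝ, Tendsto (fun k : ℕ => rescaledCorrelator (criticalCorr 3) rhoPin n (((2:ℝ) ^ k)⁻¹) y)
        atTop (𝓝 L) := by
  obtain ⟨S₀, hlim⟩ :=
    Summit.CriticalPhenomena.Ising3DConformalLimit.ExistsScaleCovariantLimitNegative.pinnedLimit_of_crux h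
  intro n y hy _
  exact ⟨S₀ n y, ((hlim n).tendsto_at hy).comp tendsto_dyad⟩

/-- **crux ⟹ S3'** (the same along `3^{-k}`). [folklore] -/
theorem triadicIntConvergence_of_crux (h : HyperoctahedralRP.ExistsScaleCovariantLimit) :
    ∀ (n : ℕ) (y : Fin n → EuclideanSpace ℝ (Fin 3)), y ∈ NonCoincident 3 n →
      (∀ i j, ∃ z : ℤ, y i j = (z : ℝ)) →
      ∃ L : ℝ, Tendsto (fun k : ℕ => rescaledCorrelator (criticalCorr 3) rhoPin n (((3:ℝ) ^ k)⁻¹) y)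
        atTop (𝓝 L) := by
  obtain ⟨S₀, hlim⟩ :=
    Summit.CriticalPhenomena.Ising3DConformalLimit.ExistsScaleCovariantLimitNegative.pinnedLimit_of_crux h
  intro n y hy _
  exact ⟨S₀ n y, ((hlim n).tendsto_at hy).comp tendsto_triad_nhdsGT⟩

/-- **Item 5955 ∧ S2' ∧ S3' ⟹ the pinned zoom converges along the full filter.** Tightness (5955 via `tight_of_orbitPrecompact`)
gives pointwise eventual bounds (B, p106941); bounds + integer-configuration convergence along `b^k` give uniqueness of the
locally-uniform cluster points WITHIN the `b`-adic family (G, p107331; `b = 2, 3`); tightness + uniqueness give K1 (S4, p97282) and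
K2 (S5, p97840); then `pinnedLimit_of_twoHierarchies`. [cite: DuminilCopinICM2022, §8.4 p. 29] -/
theorem pinnedLimit_of_orbitPrecompact_dyadicInt_triadicInt (h1 : MonotoneRG.OrbitPrecompact)
    (h2 : ∀ (n : ℕ) (y : Fin n → EuclideanSpace ℝ (Fin 3)), y ∈ NonCoincident 3 n →
      (∀ i j, ∃ z : ℤ, y i j = (z : ℝ)) →
      ∃ L : ℝ, Tendsto (fun k : ℕ => rescaledCorrelator (criticalCorr 3) rhoPin n (((2:ℝ) ^ k)⁻¹) y)
        atTop (𝓝 L))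
    (h3 : ∀ (n : ℕ) (y : Fin n → EuclideanSpace ℝ (Fin 3)), y ∈ NonCoincident 3 n →
      (∀ i j, ∃ z : ℤ, y i j = (z : ℝ)) →
      ∃ L : ℝ, Tendsto (fun k : ℕ => rescaledCorrelator (criticalCorr 3) rhoPin n (((3:ℝ) ^ k)⁻¹) y)
        atTop (𝓝 L)) :
    ∃ S : CorrFamily 3, HasPointwiseScalingLimit (criticalCorr 3) rhoPin S := by
  have ht :=
    Summit.CriticalPhenomena.Ising3DConformalLimit.ExistsScaleCovariantLimitNegative.tight_of_orbitPrecompact h1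
  have hB := stub_pointwiseBounded_of_tight ht
  have hG2 := stub_uniqueOfIntConvergence 2 le_rfl hB
  have hG3 := stub_uniqueOfIntConvergence 3 (by norm_num) hB
  simp only [natCast_two_eq] at hG2
  simp only [natCast_three_eq] at hG3
  exact pinnedLimit_of_twoHierarchies (stub_dyadicConvergence_of ht (hG2 h2)) (stub_triadicConvergence_of ht (hG3 h3))

/-- **THE CRUX IS TIGHTNESS ∧ DYADIC ∧ TRIADIC INTEGER-CONFIGURATION CONVERGENCE (importable).**
`ExistsScaleCovariantLimit ⟺ OrbitPrecompact (item 5955) ∧ S2' ∧ S3'`: beyond tightness, existence of the scale-covariant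
continuum limit of the critical `ℤ³` Ising correlators is EXACTLY the convergence of the countably many explicit real sequences
`⟨∏ᵢσ_{b^k yᵢ}⟩_{β_c}/⟨σ₀σ_{b^k e₀}⟩_{β_c}^{n/2}` (`b ∈ {2,3}`, `y` an integer non-coincident configuration) — no floors, no
renormalisation constant, no limit object quantified. [cite: DuminilCopinICM2022, §8.4 p. 29] -/
theorem crux_iff_orbitPrecompact_dyadicInt_triadicInt :
    HyperoctahedralRP.ExistsScaleCovariantLimit ↔
    (MonotoneRG.OrbitPrecompact ∧
    (∀ (n : ℕ) (y : Fin n → EuclideanSpace ℝ (Fin 3)), y ∈ NonCoincident 3 n →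
      (∀ i j, ∃ z : ℤ, y i j = (z : ℝ)) →
      ∃ L : ℝ, Tendsto (fun k : ℕ => rescaledCorrelator (criticalCorr 3) rhoPin n (((2:ℝ) ^ k)⁻¹) y)
        atTop (𝓝 L)) ∧
    (∀ (n : ℕ) (y : Fin n → EuclideanSpace ℝ (Fin 3)), y ∈ NonCoincident 3 n →
      (∀ i j, ∃ z : ℤ, y i j = (z : ℝ)) →
      ∃ L : ℝ, Tendsto (fun k : ℕ => rescaledCorrelator (criticalCorr 3) rhoPin n (((3:ℝ) ^ k)⁻¹) y)
        atTop (𝓝 L))) := by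
  constructor
  · exact fun h => ⟨orbitPrecompact_of_crux h, dyadicIntConvergence_of_crux h, triadicIntConvergence_of_crux h⟩
  · rintro ⟨h1, h2, h3⟩
    obtain ⟨S, hS⟩ := pinnedLimit_of_orbitPrecompact_dyadicInt_triadicInt h1 h2 h3
    exact Summit.CriticalPhenomena.Ising3DConformalLimit.ExistsScaleCovariantLimitNegative.crux_of_pinnedLimit hS

/-- **crux ⟺ item 4658 ∧ S2' ∧ S3'** (`UniformRegularity` in place of `OrbitPrecompact`: 5955 ⟺ 4658,
`orbitPrecompact_iff_uniformRegularity`). [cite: DuminilCopinICM2022, §8.4 p. 29] -/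
theorem crux_iff_uniformRegularity_dyadicInt_triadicInt :
    HyperoctahedralRP.ExistsScaleCovariantLimit ↔
    (MonotoneRG.UniformRegularity ∧
    (∀ (n : ℕ) (y : Fin n → EuclideanSpace ℝ (Fin 3)), y ∈ NonCoincident 3 n →
      (∀ i j, ∃ z : ℤ, y i j = (z : ℝ)) →
      ∃ L : ℝ, Tendsto (fun k : ℕ => rescaledCorrelator (criticalCorr 3) rhoPin n (((2:ℝ) ^ k)⁻¹) y)
        atTop (𝓝 L)) ∧
    (∀ (n : ℕ) (y : Fin n → EuclideanSpace ℝ (Fin 3)), y ∈ NonCoincident 3 n →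
      (∀ i j, ∃ z : ℤ, y i j = (z : ℝ)) →
      ∃ L : ℝ, Tendsto (fun k : ℕ => rescaledCorrelator (criticalCorr 3) rhoPin n (((3:ℝ) ^ k)⁻¹) y)
        atTop (𝓝 L))) := by
  rw [crux_iff_orbitPrecompact_dyadicInt_triadicInt, orbitPrecompact_iff_uniformRegularity]

/-- **crux ⟺ PairRegularity ∧ S2' ∧ S3'**: existence of the scale-covariant continuum limit of the critical `ℤ³` Ising
correlators is uniform regularity of the pinned TWO-point zoom (item 4658 at order two) plus the dyadic and triadic
integer-configuration convergences (`orbitPrecompact_iff_pairRegularity`, p119047). [cite: DuminilCopinICM2022, §8.4 p. 29] -/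
theorem crux_iff_pairRegularity_dyadicInt_triadicInt :
    HyperoctahedralRP.ExistsScaleCovariantLimit ↔
    (((∀ K : Set (Fin 2 → EuclideanSpace ℝ (Fin 3)), K ⊆ NonCoincident 3 2 → IsCompact K →
        ∃ M δ₀ : ℝ, 0 < δ₀ ∧ ∀ δ ∈ Set.Ioo 0 δ₀, ∀ x ∈ K,
          |rescaledCorrelator (criticalCorr 3) rhoPin 2 δ x| ≤ M) ∧
      (∀ K : Set (Fin 2 → EuclideanSpace ℝ (Fin 3)), K ⊆ NonCoincident 3 2 → IsCompact K →
        ∀ ε : ℝ, 0 < ε → ∃ r δ₀ : ℝ, 0 < r ∧ 0 < δ₀ ∧ ∀ δ ∈ Set.Ioo 0 δ₀, ∀ x ∈ K, ∀ y ∈ K, dist x y < r →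
          |rescaledCorrelator (criticalCorr 3) rhoPin 2 δ x - rescaledCorrelator (criticalCorr 3) rhoPin 2 δ y| < ε) ∧
      (∀ K : Set (Fin 2 → EuclideanSpace ℝ (Fin 3)), K ⊆ NonCoincident 3 2 → IsCompact K →
        ∃ m δ₀ : ℝ, 0 < m ∧ 0 < δ₀ ∧ ∀ δ ∈ Set.Ioo 0 δ₀, ∀ x ∈ K,
          m ≤ rescaledCorrelator (criticalCorr 3) rhoPin 2 δ x)) ∧
    (∀ (n : ℕ) (y : Fin n → EuclideanSpace ℝ (Fin 3)), y ∈ NonCoincident 3 n →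
      (∀ i j, ∃ z : ℤ, y i j = (z : ℝ)) →
      ∃ L : ℝ, Tendsto (fun k : ℕ => rescaledCorrelator (criticalCorr 3) rhoPin n (((2:ℝ) ^ k)⁻¹) y)
        atTop (𝓝 L)) ∧
    (∀ (n : ℕ) (y : Fin n → EuclideanSpace ℝ (Fin 3)), y ∈ NonCoincident 3 n →
      (∀ i j, ∃ z : ℤ, y i j = (z : ℝ)) →
      ∃ L : ℝ, Tendsto (fun k : ℕ => rescaledCorrelator (criticalCorr 3) rhoPin n (((3:ℝ) ^ k)⁻¹) y)
        atTop (𝓝 L))) := by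
  rw [crux_iff_orbitPrecompact_dyadicInt_triadicInt, orbitPrecompact_iff_pairRegularity]

/-- **Under item 0634 (the two-point power law `IsingEuclidUpgradeR2RotInvPowerLaw`), crux ⟺ S2' ∧ S3'**: given the two-point
law, existence of the scale-covariant continuum limit of ALL critical `ℤ³` Ising correlators is EXACTLY the convergence of the
explicit real sequences `⟨∏ᵢσ_{b^k yᵢ}⟩_{β_c}/⟨σ₀σ_{b^k e₀}⟩_{β_c}^{n/2}` (`b ∈ {2,3}`, `y ∈ (ℤ³)ⁿ` non-coincident) — item 5955
follows from 0634 by T1 (`stub_orbitPrecompact_of_twoPointLaw`, p117316). [cite: DuminilCopinICM2022, §8.4 p. 29] -/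
theorem crux_iff_dyadicInt_triadicInt_of_twoPointLaw (h0634 : IsingEuclidUpgrade.IsingEuclidUpgradeR2RotInvPowerLaw) :
    HyperoctahedralRP.ExistsScaleCovariantLimit ↔
    ((∀ (n : ℕ) (y : Fin n → EuclideanSpace ℝ (Fin 3)), y ∈ NonCoincident 3 n →
      (∀ i j, ∃ z : ℤ, y i j = (z : ℝ)) →
      ∃ L : ℝ, Tendsto (fun k : ℕ => rescaledCorrelator (criticalCorr 3) rhoPin n (((2:ℝ) ^ k)⁻¹) y)
        atTop (𝓝 L)) ∧
    (∀ (n : ℕ) (y : Fin n → EuclideanSpace ℝ (Fin 3)), y ∈ NonCoincident 3 n →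
      (∀ i j, ∃ z : ℤ, y i j = (z : ℝ)) →
      ∃ L : ℝ, Tendsto (fun k : ℕ => rescaledCorrelator (criticalCorr 3) rhoPin n (((3:ℝ) ^ k)⁻¹) y)
        atTop (𝓝 L))) := by
  rw [crux_iff_orbitPrecompact_dyadicInt_triadicInt]
  exact ⟨fun h => h.2, fun h => ⟨stub_orbitPrecompact_of_twoPointLaw h0634, h⟩⟩

/-- **Registered anchor `stub_uniquenessItemMaps`** — the package: crux ⟺ K1 ∧ K2; crux ⟺ item 5955 ∧ S2' ∧ S3'; under item 0634,
crux ⟺ S2' ∧ S3'. [cite: DuminilCopinICM2022, §8.4 p. 29] -/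
theorem stub_uniquenessItemMaps :
    (HyperoctahedralRP.ExistsScaleCovariantLimit ↔
      ((∃ S : CorrFamily 3, ∀ n : ℕ,
        TendstoLocallyUniformlyOn
          (fun k : ℕ => rescaledCorrelator (criticalCorr 3) rhoPin n (((2:ℝ) ^ k)⁻¹)) (S n) atTop
          (NonCoincident 3 n)) ∧
      (∃ S : CorrFamily 3, ∀ n : ℕ, ∀ x ∈ NonCoincident 3 n,
        Tendsto (fun k : ℕ => rescaledCorrelator (criticalCorr 3) rhoPin n (((3:ℝ) ^ k)⁻¹) x) atTop
          (𝓝 (S n x))))) ∧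
    (HyperoctahedralRP.ExistsScaleCovariantLimit ↔
      (MonotoneRG.OrbitPrecompact ∧
      (∀ (n : ℕ) (y : Fin n → EuclideanSpace ℝ (Fin 3)), y ∈ NonCoincident 3 n →
        (∀ i j, ∃ z : ℤ, y i j = (z : ℝ)) →
        ∃ L : ℝ, Tendsto (fun k : ℕ => rescaledCorrelator (criticalCorr 3) rhoPin n (((2:ℝ) ^ k)⁻¹) y)
          atTop (𝓝 L)) ∧
      (∀ (n : ℕ) (y : Fin n → EuclideanSpace ℝ (Fin 3)), y ∈ NonCoincident 3 n →
        (∀ i j, ∃ z : ℤ, y i j = (z : ℝ)) →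
        ∃ L : ℝ, Tendsto (fun k : ℕ => rescaledCorrelator (criticalCorr 3) rhoPin n (((3:ℝ) ^ k)⁻¹) y)
          atTop (𝓝 L)))) ∧
    (IsingEuclidUpgrade.IsingEuclidUpgradeR2RotInvPowerLaw →
      (HyperoctahedralRP.ExistsScaleCovariantLimit ↔
      ((∀ (n : ℕ) (y : Fin n → EuclideanSpace ℝ (Fin 3)), y ∈ NonCoincident 3 n →
        (∀ i j, ∃ z : ℤ, y i j = (z : ℝ)) →
        ∃ L : ℝ, Tendsto (fun k : ℕ => rescaledCorrelator (criticalCorr 3) rhoPin n (((2:ℝ) ^ k)⁻¹) y)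
          atTop (𝓝 L)) ∧
      (∀ (n : ℕ) (y : Fin n → EuclideanSpace ℝ (Fin 3)), y ∈ NonCoincident 3 n →
        (∀ i j, ∃ z : ℤ, y i j = (z : ℝ)) →
        ∃ L : ℝ, Tendsto (fun k : ℕ => rescaledCorrelator (criticalCorr 3) rhoPin n (((3:ℝ) ^ k)⁻¹) y)
          atTop (𝓝 L))))) :=
  ⟨crux_iff_twoHierarchies, crux_iff_orbitPrecompact_dyadicInt_triadicInt, crux_iff_dyadicInt_triadicInt_of_twoPointLaw⟩

end Summit.CriticalPhenomena.Ising3DConformalLimit.Cruxes.ExistsScaleCovariantLimit.TwoHierarchies.ItemMaps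

end
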